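import Literature.Computability.AlgebraicComplexity.DDS21DiDILStep
import Literature.Computability.AlgebraicComplexity.DDS21SizeTower
import Literature.Computability.AlgebraicComplexity.DDS21TranscriptBudget
import HarnessLib

/-!
# DDS 2021, proof of Thm. 3.2: the certificate tower in closed form and ONE stage budget for the
# trace-back transcript (`σ₀ ≤ s^{c₀·7^{k−1}}`; the precision side conditions)

Theorem-only arithmetic file (cell `val-lit`, np lane, DDS21 Thm. 3.2 programme "M-b", lead-np
RULINGS (154)(c)/(155)(a); 0 definitions, 0 named facts; sibling of `DDS21TranscriptBudget.lean`
(p2: the generic atoms of the budget currency `x ≤ s ^ a`, used here BY NAME —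
`budget_twenty_pow`, `budget_twenty_pow_mul`, `budget_succ`, `lin_le_mul_pow`) and of
`DDS21SizeTower.lean` (t18: the towers, `tower_le_pow_of_le_of_lt` used here at base `4`). Source: P. Dutta, P. Dwivedi, N. Saxena,
*Demystifying the border of depth-3 algebraic circuits*, FOCS 2021, full version
`paper:galaxy-pdf-7641649743695546420` [DuttaDwivediSaxena2022], §3, proof of Thm. 3.2: Claim 3.6
"`s_{j+1} := s_j^7 · D_j^{O(1)} · d`", "`D_{j+1} := O(d D_j) ⟹ D_j = d^{O(j)}`. Hence
`s_{j+1} = s_j^7 · d^{O(j)} ⟹ s_j ≤ (sd)^{O(j·7^j)}`. In particular `s_{k−1} ≤ s^{O(k·7^k)}`; here we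
used that `d ≤ s`" (p0033 L886–890), and "Size blowup … `S_0 = s^{O(k 7^k)}`" (p0036 L952–961).

## What is here (and for whom)

The programme's producers export ABP budgets that are explicit polynomials in the syntactic data of
the DiDIL iteration: the certificate budget `certTower N t B j` and the size bound `20^j · B` of
brick B4b (`DDS21DiDILStep.lean`, t20: `cert_didilIter`, `bdd_didilIter`), fed into the last-stage
de-bordering of brick E3 (`DDS21DiDILEndGame.lean` §9, t19: everything within `S ^ 10` once ONE
parameter `S ≥ 2` dominates `n + 1`, `t`, `N`, `B`), then dilated by the instantiation
(`DDS21TranscriptInstantiation.lean`, p1: programs within `(σ + 1) ^ 7`), and finally consumed by the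
assembly `DDS2021_thm_3_2_of_transcript` (`DDS21Thm32Assembly.lean`, p1), whose ONE hypothesis asks
for a stage budget `σ₀` with `2 ≤ σ₀ ≤ s ^ (c₀ · 7 ^ (k − 1))`, EXPLICIT `c₀`, and the precision side
conditions `deg f < D`, `r < D`, `D ≤ σ₀` of the trace-back export
`uabpComputes_of_traceBackTranscript_lin'` (`DDS21TraceBackAssembly.lean`, t24). This file closes the
arithmetic between them, once, for arbitrary parameters and with explicit constants:

* §1 `certTower_succ'`: the forward form of t20's continuation-style recursion,
  `certTower N t B (j+1) = (4·(20^j·B) + 2)·N^8·(certTower N t B j)^4`.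
* §2 ★`certTower_le_pow`: the closed form
  `certTower N t B j ≤ s^{(e + β + 8ν + 5j)·4^j}` from `t ≤ s^e`, `N ≤ s^ν`, `4B + 2 ≤ s^β`, by
  t18's tower lemma `tower_le_pow_of_le_of_lt` (base `a = 4`: the certificate step is quartic).
* §3 one parameter, in the binder shape of `DDS2021_thm_3_2` (`1 ≤ k ≤ s`, `d, n ≤ s`, `2 ≤ s`):
  `succ_mul_four_pow_le` (`(m+1)·4^m ≤ 2·7^m`, the passage from the quartic tower to the printed
  `7^j`), and ★★`transcriptBudget`: with `S := s ^ (90 · 7^(k−1))`, `2 ≤ S`, `n + 1 ≤ S`,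
  `20^(k−1)·d + 1 ≤ S`, `20^j·d ≤ S` and `certTower (20^(k−1)·d + 1) 1 d j ≤ S` for every round
  `j < k` (stage-0 data of t20's `exists_stageZero`: fan-in `t = 1`, size `B = d`; certificate
  degree `N := 20^(k−1)·d + 1 > 20^j·d`, `size_lt_certDegree`); the parametric-`N` form
  `certTower_le_stagePow`; and the two budget polynomials the producers carry, each within
  `S^10`: `swsBudget_le_pow` (Lemma 2.23's `Σ∧Σ` pieces), `spsBudget_le_pow` (`ΠΣ` reductions).
* §3b the run towers in the SEQUENCE form of x5's `exists_didil_run(_stageZero)`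
  (`DDS21TranscriptResidues.lean`: `Bs (j+1) = 20·Bs j`, `ts (j+1) = (4·Bs j + 2)·N⁸·(ts j)⁴`):
  `run_Bs_eq`, `run_ts_eq_certTower` (they ARE `20^j·Bs 0` and `certTower N (ts 0) (Bs 0) j`),
  `certDegree_le`, and ★★`run_towers_le` (every stage `j ≤ r < k` within `s^(90·7^(k−1))`,
  `Bs j < 20^(k−1)·d + 1`).
* §4 absorption into the assembly's `σ₀ ≤ s^(c₀·7^(k−1))`: `pow_le_stagePow`
  (`S ≤ s^(C·7^(k−1)) ⟹ S^m ≤ s^(C·m·7^(k−1))`), `succ_pow_le_stagePow`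
  (`⟹ (S+1)^m ≤ s^((C+1)·m·7^(k−1))`), and the corollary for the programme's actual composite
  `σ := S^10` (E3) and `σ₀ := (σ + 1)^7` (instantiation): ★`stageBudget_of_transcriptBudget`,
  `2 ≤ (S^10 + 1)^7 ≤ s^(6307 · 7^(k−1))` at `S = s^(90·7^(k−1))`, i.e. `c₀ = 6307`.
* ★★`residueChainBudget`: the three budget conjuncts of p1's `DDS2021_thm_3_2_of_residueChain`
  (`(σ+1)^7 ≤ s^(6307·7^(k−1))`, `2 ≤ σ`, `deg f♯ + k ≤ σ`) at `σ := S^10`, discharged.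
* §6 (v2) the same three conjuncts at a parametric program exponent `σ := S^m`
  (`residueChainBudget_pow`, `c₀ = (90m+1)·7`; `stagePow_pow_mono`, `le_stagePow_pow`).
* §5 the precision side conditions of `…_lin'` (`hdeg : deg f < D`, `hrd : r < D`, `hdσ : D ≤ σ₀`)
  with `D := 2·s` (`precision_two_mul`) or the (α′) choice `D := deg f + r + 1`
  (`precision_deg_add`), from `deg f ≤ d ≤ s` (for a border-`Σ^{[k]}Π^{[d]}Σ` polynomial this is
  `totalDegree_le_of_mem_border_spsClass`, `DDS21TopFaninTwoABP.lean`), `r < k ≤ s`, `s² ≤ σ₀`.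

Honest framing: pure arithmetic for the assemblers; `DDS2021_thm_3_2` (and `_5_1`) stay OPEN by
name; VP ≠ VNP is NOT proved and nothing here bears on it.

## References

* [DuttaDwivediSaxena2022] P. Dutta, P. Dwivedi, N. Saxena, *Demystifying the border of depth-3
  algebraic circuits*, Proc. 62nd FOCS (2021), IEEE 2022, 92–103; full version: Thm. 3.2
  (p0026 L710–717), Claim 3.6 and the size recursion (p0033 L873–890), "Size blowup"
  (p0036 L952–961).
-/

namespace Literature.Computability.AlgebraicComplexity

namespace DDS2021

/-! ### §1 The certificate tower in forward form -/

/-- **Forward form of the certificate tower.** t20's `certTower` is defined continuation-style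
(`certTower N t B (j+1) = certTower N ((4B+2)N⁸t⁴) (20B) j`); unrolled from the other end it is the
quartic recursion `c_{j+1} = (4·B_j + 2)·N⁸·c_j⁴` with `B_j = 20^j·B` (B4b: `Cert.didil`,
`bdd_didil`). [cite: DuttaDwivediSaxena2022, §3 proof of Thm. 3.2, Claim 3.6 size recursion (full version p0033 L880–890)] -/
theorem certTower_succ' (N : ℕ) : ∀ (j t B : ℕ),
    certTower N t B (j + 1) = (4 * (20 ^ j * B) + 2) * N ^ 8 * certTower N t B j ^ 4 := by
  intro j
  induction j with
  | zero =>
    intro t B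
    rw [certTower_succ, certTower_zero, certTower_zero, pow_zero, one_mul]
  | succ j ih =>
    intro t B
    rw [certTower_succ N t B (j + 1), ih, ← certTower_succ N t B j, pow_succ]
    ring

/-! ### §2 Closed form of the certificate tower -/

/-- One step of the tower is within `s^{β + 8ν + 5j}` times the fourth power of the previous budget.
[cite: DuttaDwivediSaxena2022, §3 proof of Thm. 3.2, Claim 3.6 size recursion "`s_{j+1} := s_j^7 · D_j^{O(1)} · d`" (full version p0033 L886–887)] -/
theorem certTower_succ_le {s N t B ν β : ℕ} (hs : 2 ≤ s) (hN : N ≤ s ^ ν) (hB : 4 * B + 2 ≤ s ^ β)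
    (j : ℕ) : certTower N t B (j + 1) ≤ certTower N t B j ^ 4 * s ^ (β + 8 * ν + 5 * j) := by
  rw [certTower_succ']
  have h20 : 1 ≤ 20 ^ j := Nat.one_le_pow _ _ (by norm_num)
  have hM : 4 * (20 ^ j * B) + 2 ≤ s ^ β * s ^ (5 * j) := by
    calc 4 * (20 ^ j * B) + 2 ≤ (4 * B + 2) * 20 ^ j := by nlinarith
      _ ≤ s ^ β * s ^ (5 * j) := Nat.mul_le_mul hB (budget_twenty_pow hs j)
  have hN8 : N ^ 8 ≤ (s ^ ν) ^ 8 := Nat.pow_le_pow_left hN 8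
  calc (4 * (20 ^ j * B) + 2) * N ^ 8 * certTower N t B j ^ 4
      ≤ (s ^ β * s ^ (5 * j)) * (s ^ ν) ^ 8 * certTower N t B j ^ 4 :=
        Nat.mul_le_mul_right _ (Nat.mul_le_mul hM hN8)
    _ = certTower N t B j ^ 4 * s ^ (β + 8 * ν + 5 * j) := by ring

/-- ★ **Closed form of the certificate tower.** If the initial fan-in is `t ≤ s^e`, the certificate
degree `N ≤ s^ν` and the initial size satisfies `4B + 2 ≤ s^β` (`s ≥ 2`), then after `j` rounds
`certTower N t B j ≤ s^{(e + β + 8ν + 5j) · 4^j}` — the printed "`s_j ≤ (sd)^{O(j·7^j)}`" with the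
tree's quartic certificate step (t18's `tower_le_pow_of_le_of_lt` at `a = 4`).
[cite: DuttaDwivediSaxena2022, §3 proof of Thm. 3.2, Claim 3.6 "`s_j ≤ (sd)^{O(j·7^j)}`" (full version p0033 L886–890)] -/
theorem certTower_le_pow {s N t B e ν β : ℕ} (hs : 2 ≤ s) (ht : t ≤ s ^ e) (hN : N ≤ s ^ ν)
    (hB : 4 * B + 2 ≤ s ^ β) (j : ℕ) :
    certTower N t B j ≤ s ^ ((e + (β + 8 * ν + 5 * j)) * 4 ^ j) := by
  have h := tower_le_pow_of_le_of_lt (s := s) (a := 4) (e := e) (B := β + 8 * ν + 5 * j) (k := j)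
    (fun i => certTower N t B i) (fun i => β + 8 * ν + 5 * i) (by omega) (by norm_num)
    (by rw [certTower_zero]; exact ht) (fun i hi => by omega)
    (fun i _ => certTower_succ_le hs hN hB i)
  exact h

/-! ### §3 One parameter (the binder shape of `DDS2021_thm_3_2`) -/

/-- `(m+1)·4^m ≤ 2·7^m`: the quartic certificate tower with its `O(k)` polynomial factors fits the
printed stage exponent `O(7^{k−1})` with an ABSOLUTE constant. (folklore)
[cite: DuttaDwivediSaxena2022, §3 proof of Thm. 3.2, "`s_{k−1} ≤ s^{O(k·7^k)}`" (full version p0033 L889–890)] -/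
theorem succ_mul_four_pow_le : ∀ m : ℕ, (m + 1) * 4 ^ m ≤ 2 * 7 ^ m
  | 0 => by norm_num
  | 1 => by norm_num
  | m + 2 => by
    have ih := succ_mul_four_pow_le (m + 1)
    calc (m + 2 + 1) * 4 ^ (m + 2) = 4 * (m + 3) * 4 ^ (m + 1) := by ring
      _ ≤ 7 * (m + 2) * 4 ^ (m + 1) := Nat.mul_le_mul_right _ (by omega)
      _ = 7 * ((m + 1 + 1) * 4 ^ (m + 1)) := by ring
      _ ≤ 7 * (2 * 7 ^ (m + 1)) := Nat.mul_le_mul_left _ ih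
      _ = 2 * 7 ^ (m + 2) := by ring

/-- `k·4^{k−1} ≤ 2·7^{k−1}` (`succ_mul_four_pow_le` in the `k − 1` indexing of the assembly).
(folklore) [cite: DuttaDwivediSaxena2022, §3 proof of Thm. 3.2 (full version p0033 L889–890)] -/
theorem mul_four_pow_le (k : ℕ) : k * 4 ^ (k - 1) ≤ 2 * 7 ^ (k - 1) := by
  rcases k with _ | m
  · simp
  · simpa using succ_mul_four_pow_le m

/-- The certificate tower within ONE stage power: for `s ≥ 2`, `d ≤ s`, any certificate degree
`N ≤ s^{5(k−1)+2}` (e.g. `N = 20^{k−1}·d + 1`), stage-0 fan-in `1` and size `d`, and every round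
`j < k`: `certTower N 1 d j ≤ s^{90·7^{k−1}}`.
[cite: DuttaDwivediSaxena2022, §3 proof of Thm. 3.2, Claim 3.6 "`s_{k−1} ≤ s^{O(k·7^k)}`; here we used that `d ≤ s`" (full version p0033 L886–890)] -/
theorem certTower_le_stagePow {s d k N j : ℕ} (hs : 2 ≤ s) (hds : d ≤ s)
    (hN : N ≤ s ^ (5 * (k - 1) + 2)) (hj : j < k) :
    certTower N 1 d j ≤ s ^ (90 * 7 ^ (k - 1)) := by
  have hs1 : 1 ≤ s := by omega
  -- `4d + 2 ≤ s^4`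
  have hβ : 4 * d + 2 ≤ s ^ 4 := by
    have h8 : 8 ≤ s ^ 3 := le_trans (by norm_num : 8 ≤ 2 ^ 3) (Nat.pow_le_pow_left hs 3)
    have : 4 * d + 2 ≤ 8 * s := by omega
    calc 4 * d + 2 ≤ 8 * s := this
      _ ≤ s ^ 3 * s := Nat.mul_le_mul_right _ h8
      _ = s ^ 4 := by ring
  have h := certTower_le_pow (e := 0) hs (le_of_eq (pow_zero s).symm) hN hβ j
  refine h.trans (Nat.pow_le_pow_right hs1 ?_)
  -- exponent: `(0 + (4 + 8(5(k−1)+2) + 5j))·4^j ≤ 90·7^(k−1)` for `j ≤ k − 1`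
  obtain ⟨m, rfl⟩ : ∃ m, k = m + 1 := ⟨k - 1, by omega⟩
  simp only [Nat.add_sub_cancel] at *
  have hjm : j ≤ m := by omega
  have h4 : 4 ^ j ≤ 4 ^ m := Nat.pow_le_pow_right (by norm_num) hjm
  have key := succ_mul_four_pow_le m
  calc (0 + (4 + 8 * (5 * m + 2) + 5 * j)) * 4 ^ j ≤ (45 * (m + 1)) * 4 ^ m :=
        Nat.mul_le_mul (by omega) h4
    _ = 45 * ((m + 1) * 4 ^ m) := by ring
    _ ≤ 45 * (2 * 7 ^ m) := Nat.mul_le_mul_left _ key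
    _ = 90 * 7 ^ m := by ring

/-- ★★ **One stage budget for the whole transcript** (the `hs/hn/ht/hNs/hBs` inputs of E3's
`ExactTerm.uabp_residue_le` / `_scaled_le` at every round, and `2 ≤ S`): in the binder shape of
`DDS2021_thm_3_2` (`1 ≤ k ≤ s`, `d ≤ s`, `n ≤ s`, `2 ≤ s`), the ONE parameter
`S := s ^ (90 · 7^(k−1))` dominates `2`, `n + 1`, the certificate degree `N := 20^(k−1)·d + 1`, the
size bounds `20^j·d` (`bdd_didilIter` from stage-0 size `d`) and the certificate budgets
`certTower N 1 d j` (`cert_didilIter` from stage-0 fan-in `1`) of every round `j < k`.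
[cite: DuttaDwivediSaxena2022, §3 proof of Thm. 3.2, Claim 3.6 size recursion and "`s_{k−1} ≤ s^{O(k·7^k)}`" (full version p0033 L880–890); "Size blowup" (p0036 L952–961)] -/
theorem transcriptBudget {n d k s : ℕ} (hk : 1 ≤ k) (hds : d ≤ s) (hns : n ≤ s) (hs : 2 ≤ s) :
    2 ≤ s ^ (90 * 7 ^ (k - 1)) ∧ n + 1 ≤ s ^ (90 * 7 ^ (k - 1)) ∧
      20 ^ (k - 1) * d + 1 ≤ s ^ (90 * 7 ^ (k - 1)) ∧
      (∀ j, j < k → 20 ^ j * d ≤ s ^ (90 * 7 ^ (k - 1))) ∧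
      ∀ j, j < k → certTower (20 ^ (k - 1) * d + 1) 1 d j ≤ s ^ (90 * 7 ^ (k - 1)) := by
  have hs1 : 1 ≤ s := by omega
  have h7 : 1 ≤ 7 ^ (k - 1) := Nat.one_le_pow _ _ (by norm_num)
  have hE2 : 2 ≤ 90 * 7 ^ (k - 1) := by omega
  -- size bounds `20^j·d ≤ s^(5j+1)`
  have hBj : ∀ j, 20 ^ j * d ≤ s ^ (5 * j + 1) := fun j => budget_twenty_pow_mul hs hds j
  -- the certificate degree `N ≤ s^(5(k−1)+2)`
  have hN : 20 ^ (k - 1) * d + 1 ≤ s ^ (5 * (k - 1) + 2) := budget_succ hs (hBj (k - 1))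
  have hlin : 5 * (k - 1) + 2 ≤ 90 * 7 ^ (k - 1) := by
    have h := lin_le_mul_pow (a := 2) (b := 5) (t := 7) (by norm_num) (k - 1)
    omega
  refine ⟨?_, ?_, hN.trans (Nat.pow_le_pow_right hs1 hlin), fun j hj => ?_, fun j hj =>
    certTower_le_stagePow hs hds hN hj⟩
  · exact le_trans hs (le_trans (le_of_eq (pow_one s).symm) (Nat.pow_le_pow_right hs1 (by omega)))
  · have h2 : n + 1 ≤ s ^ 2 := by nlinarith
    exact h2.trans (Nat.pow_le_pow_right hs1 hE2)
  · refine (hBj j).trans (Nat.pow_le_pow_right hs1 (le_trans ?_ hlin))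
    omega

/-- The size bound of round `j < k` is below the certificate degree `N := 20^(k−1)·d + 1` (E3's
`hBN : B < N`). [cite: DuttaDwivediSaxena2022, §3 proof of Thm. 3.2, Claim 3.6 degree recursion (full version p0033 L880–887)] -/
theorem size_lt_certDegree {d k j : ℕ} (hj : j < k) : 20 ^ j * d < 20 ^ (k - 1) * d + 1 :=
  Nat.lt_succ_of_le (Nat.mul_le_mul_right d (Nat.pow_le_pow_right (by norm_num) (by omega)))

/-- The `Σ∧Σ`-piece budget of Lemma 2.23 (`uabpComputes_of_mem_border_swsClass`:
`(n+1)·(t·((n+1)·N + 1)) + N + 2`) is within `S^10` once `S ≥ 2` dominates `n + 1`, `t`, `N`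
(cf. E3's `endGameBudget_le_pow`, which bounds the whole top-pair budget).
[cite: DuttaDwivediSaxena2022, Lemma 2.23 (full version p0025 L661–664); Thm. 3.2 "size `s^{O(k·7^k)}`" (p0026 L713–715)] -/
theorem swsBudget_le_pow {n t N S : ℕ} (hS : 2 ≤ S) (hn : n + 1 ≤ S) (ht : t ≤ S) (hN : N ≤ S) :
    (n + 1) * (t * ((n + 1) * N + 1)) + N + 2 ≤ S ^ 10 := by
  have h1 : (n + 1) * N ≤ S * S := Nat.mul_le_mul hn hN
  have h2 : (n + 1) * (t * ((n + 1) * N + 1)) ≤ S * (S * (S * S + 1)) :=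
    Nat.mul_le_mul hn (Nat.mul_le_mul ht (by omega))
  have h3 : S * (S * (S * S + 1)) + S + 2 ≤ S ^ 10 := by
    have hS4 : 16 ≤ S ^ 4 := le_trans (by norm_num : 16 ≤ 2 ^ 4) (Nat.pow_le_pow_left hS 4)
    have hS1 : S ≤ S ^ 4 := by
      calc S = S ^ 1 := (pow_one S).symm
        _ ≤ S ^ 4 := Nat.pow_le_pow_right (by omega) (by norm_num)
    have e : S * (S * (S * S + 1)) = S ^ 4 + S ^ 2 := by ring
    have hS2 : S ^ 2 ≤ S ^ 4 := Nat.pow_le_pow_right (by omega) (by norm_num)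
    have h10 : 4 * S ^ 4 ≤ S ^ 10 := by
      calc 4 * S ^ 4 ≤ S ^ 4 * S ^ 4 := Nat.mul_le_mul_right _ (le_trans (by norm_num) hS4)
        _ = S ^ 8 := by ring
        _ ≤ S ^ 10 := Nat.pow_le_pow_right (by omega) (by norm_num)
    omega
  omega

/-- The `ΠΣ` budget of `uabpComputes_of_mem_spsClass` for `≤ B` affine factors
(`1·(2 + B·((n+1)·2 + 2)) + 2`) is within `S^10` once `S ≥ 2` dominates `n + 1`, `B`.
[cite: DuttaDwivediSaxena2022, §3 proof of Thm. 3.2, `k = 1` case (full version p0026 L716); Thm. 3.2 (p0026 L713–715)] -/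
theorem spsBudget_le_pow {n B S : ℕ} (hS : 2 ≤ S) (hn : n + 1 ≤ S) (hB : B ≤ S) :
    1 * (2 + B * ((n + 1) * 2 + 2)) + 2 ≤ S ^ 10 := by
  have h1 : B * ((n + 1) * 2 + 2) ≤ S * (S * 2 + 2) := Nat.mul_le_mul hB (by omega)
  have e : S * (S * 2 + 2) = 2 * S ^ 2 + 2 * S := by ring
  have hS2 : 4 ≤ S ^ 2 := le_trans (by norm_num : 4 ≤ 2 ^ 2) (Nat.pow_le_pow_left hS 2)
  have hS1 : S ≤ S ^ 2 := by nlinarith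
  have h10 : 6 * S ^ 2 ≤ S ^ 10 := by
    calc 6 * S ^ 2 ≤ S ^ 2 * S ^ 2 * S ^ 2 := by nlinarith
      _ = S ^ 6 := by ring
      _ ≤ S ^ 10 := Nat.pow_le_pow_right (by omega) (by norm_num)
  omega

/-- The certificate degree `N := 20^(k−1)·d + 1` is within `s^(5(k−1)+2)` (`d ≤ s`, `s ≥ 2`) — the
`hN` input of `certTower_le_stagePow` / `run_towers_le`.
[cite: DuttaDwivediSaxena2022, §3 proof of Thm. 3.2, Claim 3.6 degree recursion (full version p0033 L880–889)] -/
theorem certDegree_le {s d k : ℕ} (hs : 2 ≤ s) (hds : d ≤ s) :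
    20 ^ (k - 1) * d + 1 ≤ s ^ (5 * (k - 1) + 2) :=
  budget_succ hs (budget_twenty_pow_mul hs hds (k - 1))

/-! ### §3b The run towers in sequence form (`DDS21TranscriptResidues.lean`, x5)

The F(x)-side run `exists_didil_run(_stageZero)` records its size and certificate towers as
SEQUENCES `Bs ts : ℕ → ℕ` with `Bs (j+1) = 20 · Bs j`, `ts (j+1) = (4·Bs j + 2)·N⁸·(ts j)⁴`
(`j < r`); these are `20^j · Bs 0` and t20's `certTower N (ts 0) (Bs 0) j`, hence within the one
stage budget. -/

/-- The run's size tower is `Bs j = 20^j · Bs 0` (`j ≤ r`).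
[cite: DuttaDwivediSaxena2022, §3 proof of Thm. 3.2, Claim 3.6 "`D_{j+1} := O(d D_j)`" (full version p0033 L880–888)] -/
theorem run_Bs_eq (Bs : ℕ → ℕ) {r : ℕ} (hBs : ∀ j, j < r → Bs (j + 1) = 20 * Bs j) :
    ∀ j, j ≤ r → Bs j = 20 ^ j * Bs 0 := by
  intro j
  induction j with
  | zero => intro _; rw [pow_zero, one_mul]
  | succ j ih =>
    intro hj
    rw [hBs j (by omega), ih (by omega), pow_succ]
    ring

/-- The run's certificate tower is t20's `certTower`: `ts j = certTower N (ts 0) (Bs 0) j` (`j ≤ r`).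
[cite: DuttaDwivediSaxena2022, §3 proof of Thm. 3.2, Claim 3.6 size recursion (full version p0033 L880–890)] -/
theorem run_ts_eq_certTower (Bs ts : ℕ → ℕ) {N r : ℕ}
    (hBs : ∀ j, j < r → Bs (j + 1) = 20 * Bs j)
    (hts : ∀ j, j < r → ts (j + 1) = (4 * Bs j + 2) * N ^ 8 * ts j ^ 4) :
    ∀ j, j ≤ r → ts j = certTower N (ts 0) (Bs 0) j := by
  intro j
  induction j with
  | zero => intro _; rw [certTower_zero]
  | succ j ih =>
    intro hj
    rw [hts j (by omega), ih (by omega), certTower_succ', run_Bs_eq Bs hBs j (by omega)]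

/-- ★★ **The run towers within the one stage budget** (x5's binder shape): for a run of `r < k`
rounds from stage-0 data `Bs 0 = d`, `ts 0 = 1` with certificate degree `N ≤ s^(5(k−1)+2)`
(e.g. `N := 20^(k−1)·d + 1`, `certDegree_le`), every stage `j ≤ r` has
`Bs j ≤ s^(90·7^(k−1))`, `ts j ≤ s^(90·7^(k−1))`, and `Bs j < 20^(k−1)·d + 1`.
[cite: DuttaDwivediSaxena2022, §3 proof of Thm. 3.2, Claim 3.6 "`s_{k−1} ≤ s^{O(k·7^k)}`" (full version p0033 L880–890)] -/
theorem run_towers_le {s d k N r : ℕ} (hs : 2 ≤ s) (hds : d ≤ s) (hrk : r < k)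
    (hN : N ≤ s ^ (5 * (k - 1) + 2)) (Bs ts : ℕ → ℕ) (hB0 : Bs 0 = d) (ht0 : ts 0 = 1)
    (hBs : ∀ j, j < r → Bs (j + 1) = 20 * Bs j)
    (hts : ∀ j, j < r → ts (j + 1) = (4 * Bs j + 2) * N ^ 8 * ts j ^ 4) :
    ∀ j, j ≤ r → Bs j ≤ s ^ (90 * 7 ^ (k - 1)) ∧ ts j ≤ s ^ (90 * 7 ^ (k - 1)) ∧
      Bs j < 20 ^ (k - 1) * d + 1 := by
  intro j hj
  have hjk : j < k := by omega
  have hs1 : 1 ≤ s := by omega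
  have hB : Bs j = 20 ^ j * d := by rw [run_Bs_eq Bs hBs j hj, hB0]
  have hT : ts j = certTower N 1 d j := by rw [run_ts_eq_certTower Bs ts hBs hts j hj, ht0, hB0]
  refine ⟨?_, hT ▸ certTower_le_stagePow hs hds hN hjk, hB ▸ size_lt_certDegree hjk⟩
  rw [hB]
  refine (budget_twenty_pow_mul hs hds j).trans (Nat.pow_le_pow_right hs1 ?_)
  have h := lin_le_mul_pow (a := 2) (b := 5) (t := 7) (by norm_num) (k - 1)
  have h90 : (2 + 5) * 7 ^ (k - 1) ≤ 90 * 7 ^ (k - 1) := Nat.mul_le_mul_right _ (by norm_num)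
  omega

/-! ### §4 Absorption into the assembly's `σ₀ ≤ s ^ (c₀ · 7 ^ (k − 1))` -/

/-- Powers of a stage budget are stage budgets: `S ≤ s^(C·7^(k−1)) ⟹ S^m ≤ s^(C·m·7^(k−1))`.
[cite: DuttaDwivediSaxena2022, §3 proof of Thm. 3.2, "Size blowup" (full version p0036 L952–961)] -/
theorem pow_le_stagePow {s S C k : ℕ} (hS : S ≤ s ^ (C * 7 ^ (k - 1))) (m : ℕ) :
    S ^ m ≤ s ^ (C * m * 7 ^ (k - 1)) := by
  calc S ^ m ≤ (s ^ (C * 7 ^ (k - 1))) ^ m := Nat.pow_le_pow_left hS m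
    _ = s ^ (C * m * 7 ^ (k - 1)) := by rw [← pow_mul]; ring_nf

/-- Successors too: `2 ≤ s`, `S ≤ s^(C·7^(k−1)) ⟹ (S + 1)^m ≤ s^((C+1)·m·7^(k−1))`.
[cite: DuttaDwivediSaxena2022, §3 proof of Thm. 3.2, "Size blowup" (full version p0036 L952–961)] -/
theorem succ_pow_le_stagePow {s S C k : ℕ} (hs : 2 ≤ s) (hS : S ≤ s ^ (C * 7 ^ (k - 1))) (m : ℕ) :
    (S + 1) ^ m ≤ s ^ ((C + 1) * m * 7 ^ (k - 1)) := by
  have h7 : 1 ≤ 7 ^ (k - 1) := Nat.one_le_pow _ _ (by norm_num)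
  have h1 : S + 1 ≤ s ^ ((C + 1) * 7 ^ (k - 1)) :=
    (budget_succ hs hS).trans (Nat.pow_le_pow_right (by omega) (by nlinarith))
  exact pow_le_stagePow h1 m

/-- ★ **The programme's composite stage budget.** With `S := s^(90·7^(k−1))` (`transcriptBudget`),
the last-stage de-bordering exports programs and degrees within `σ := S^10`
(`ExactTerm.uabp_residue_le`), the instantiation dilates them within `(σ + 1)^7`
(`UABPComputes.dilShift`), and `σ₀ := (S^10 + 1)^7` satisfies the assembly's
`2 ≤ σ₀ ≤ s^(c₀·7^(k−1))` with `c₀ = 6307`, together with `s² ≤ σ₀` (for the precision, §5) and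
`S^10 ≤ σ₀`. [cite: DuttaDwivediSaxena2022, Thm. 3.2 "size `s^{O(k·7^k)}`" (full version p0026 L713–715); §3 "Size blowup" (p0036 L952–961)] -/
theorem stageBudget_of_transcriptBudget {s k : ℕ} (hs : 2 ≤ s) :
    2 ≤ (((s ^ (90 * 7 ^ (k - 1))) ^ 10 + 1) ^ 7) ∧
      s ^ 2 ≤ ((s ^ (90 * 7 ^ (k - 1))) ^ 10 + 1) ^ 7 ∧
      (s ^ (90 * 7 ^ (k - 1))) ^ 10 ≤ ((s ^ (90 * 7 ^ (k - 1))) ^ 10 + 1) ^ 7 ∧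
      ((s ^ (90 * 7 ^ (k - 1))) ^ 10 + 1) ^ 7 ≤ s ^ (6307 * 7 ^ (k - 1)) := by
  have hs1 : 1 ≤ s := by omega
  have h7 : 1 ≤ 7 ^ (k - 1) := Nat.one_le_pow _ _ (by norm_num)
  set S := s ^ (90 * 7 ^ (k - 1)) with hSdef
  have hS2 : s ^ 2 ≤ S := Nat.pow_le_pow_right hs1 (by omega)
  have hσ : S ^ 10 ≤ s ^ (90 * 10 * 7 ^ (k - 1)) := pow_le_stagePow (le_refl S) 10
  have hbase : S ^ 10 ≤ (S ^ 10 + 1) ^ 7 := by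
    calc S ^ 10 = (S ^ 10) ^ 1 := (pow_one _).symm
      _ ≤ (S ^ 10 + 1) ^ 1 := Nat.pow_le_pow_left (Nat.le_succ _) 1
      _ ≤ (S ^ 10 + 1) ^ 7 := Nat.pow_le_pow_right (by omega) (by norm_num)
  have hS10 : s ^ 2 ≤ S ^ 10 := by
    calc s ^ 2 ≤ S := hS2
      _ = S ^ 1 := (pow_one S).symm
      _ ≤ S ^ 10 := Nat.pow_le_pow_right (by nlinarith) (by norm_num)
  refine ⟨?_, hS10.trans hbase, hbase, ?_⟩
  · have : 2 ≤ s ^ 2 := by nlinarith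
    exact this.trans (hS10.trans hbase)
  · have h := succ_pow_le_stagePow (C := 90 * 10) (k := k) hs hσ 7
    refine h.trans (Nat.pow_le_pow_right hs1 (le_of_eq ?_))
    ring

/-- ★★ **The budget conjuncts of the assembly's ONE hypothesis, discharged** — in the exact shape of
`DDS2021_thm_3_2_of_residueChain` (`DDS21TranscriptInstantiation.lean`, p1): with the producers'
program/degree budget `σ := S^10`, `S := s^(90·7^(k−1))` (E3 §9 at the one parameter `S` of
`transcriptBudget` / `run_towers_le`), the three arithmetic conjuncts
`(σ + 1)^7 ≤ s^(c₀·7^(k−1))` (here `c₀ = 6307`), `2 ≤ σ`, and `deg f♯ + k ≤ σ` (for any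
`deg f♯ ≤ d`, e.g. `f♯ = map ι f` of a border-`Σ^{[k]}Π^{[d]}Σ` polynomial, `d, k ≤ s`) hold.
[cite: DuttaDwivediSaxena2022, Thm. 3.2 "size `s^{O(k·7^k)}`" (full version p0026 L713–715); §3 "Size blowup" (p0036 L952–961)] -/
theorem residueChainBudget {d k s δ : ℕ} (hks : k ≤ s) (hds : d ≤ s) (hs : 2 ≤ s) (hδ : δ ≤ d) :
    ((s ^ (90 * 7 ^ (k - 1))) ^ 10 + 1) ^ 7 ≤ s ^ (6307 * 7 ^ (k - 1)) ∧
      2 ≤ (s ^ (90 * 7 ^ (k - 1))) ^ 10 ∧ δ + k ≤ (s ^ (90 * 7 ^ (k - 1))) ^ 10 := by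
  obtain ⟨_, h2, h10, hσ⟩ := stageBudget_of_transcriptBudget (k := k) hs
  have hs1 : 1 ≤ s := by omega
  have hS2 : s ^ 2 ≤ s ^ (90 * 7 ^ (k - 1)) :=
    Nat.pow_le_pow_right hs1 (le_trans (by norm_num) (Nat.mul_le_mul_left 90 (Nat.one_le_pow _ _ (by norm_num))))
  have hS10 : s ^ (90 * 7 ^ (k - 1)) ≤ (s ^ (90 * 7 ^ (k - 1))) ^ 10 :=
    Nat.le_self_pow (by norm_num) _
  have hsq : δ + k ≤ s ^ 2 := by nlinarith
  have h2s : 2 ≤ s ^ 2 := by nlinarith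
  exact ⟨hσ, h2s.trans (hS2.trans hS10), hsq.trans (hS2.trans hS10)⟩

/-! ### §5 The precision side conditions of the trace-back export -/

/-- **Precision `D := 2·s`** for `uabpComputes_of_traceBackTranscript_lin'` (`hdeg : deg f < D`,
`hrd : r < D`, `hdσ : D ≤ σ₀`): from `deg f ≤ d ≤ s` (border-`Σ^{[k]}Π^{[d]}Σ` polynomials have
degree `≤ d`: `totalDegree_le_of_mem_border_spsClass`), `r < k ≤ s` rounds, `2 ≤ s`, `s² ≤ σ₀`.
[cite: DuttaDwivediSaxena2022, §3 proof of Thm. 3.2, the final congruence "mod `z^d`" read at precision exceeding the degree (full version p0030 L808–812, p0036 L952–956)] -/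
theorem precision_two_mul {δ d r k s σ₀ : ℕ} (hδ : δ ≤ d) (hds : d ≤ s) (hr : r < k) (hks : k ≤ s)
    (hs : 2 ≤ s) (hσ : s ^ 2 ≤ σ₀) : δ < 2 * s ∧ r < 2 * s ∧ 2 * s ≤ σ₀ := by
  refine ⟨by omega, by omega, le_trans ?_ hσ⟩
  nlinarith

/-- **Precision `D := deg f + r + 1`** (the (α′) choice `d_j = d − j`, `d := deg f + r + 1`): the
same three side conditions. [cite: DuttaDwivediSaxena2022, §3 proof of Thm. 3.2 (full version p0030 L808–812, p0036 L952–956)] -/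
theorem precision_deg_add {δ d r k s σ₀ : ℕ} (hδ : δ ≤ d) (hds : d ≤ s) (hr : r < k) (hks : k ≤ s)
    (hs : 2 ≤ s) (hσ : s ^ 2 ≤ σ₀) : δ < δ + r + 1 ∧ r < δ + r + 1 ∧ δ + r + 1 ≤ σ₀ := by
  refine ⟨by omega, by omega, le_trans ?_ hσ⟩
  nlinarith

/-- The polynomial form of `precision_two_mul`: for any `f` with `f.totalDegree ≤ d ≤ s`.
[cite: DuttaDwivediSaxena2022, §3 proof of Thm. 3.2 (full version p0030 L808–812, p0036 L952–956)] -/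
theorem precision_two_mul_poly {R σ : Type*} [CommSemiring R] {f : MvPolynomial σ R}
    {d r k s σ₀ : ℕ} (hf : f.totalDegree ≤ d) (hds : d ≤ s) (hr : r < k) (hks : k ≤ s)
    (hs : 2 ≤ s) (hσ : s ^ 2 ≤ σ₀) :
    f.totalDegree < 2 * s ∧ r < 2 * s ∧ 2 * s ≤ σ₀ :=
  precision_two_mul hf hds hr hks hs hσ

/-! ### §6 (v2) Parametric program exponent: `σ := S^m`

If a producer's last one-parameter step lands at `S^m` rather than `S^10` (e.g. quotient families
certified at `N²t²`, sizes `2B`, so that the one parameter is a power of `S`), the composer takes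
`σ := S^m` for the largest `m` in play (`UABPComputes.mono` along `pow_le_pow_right`); the three
budget conjuncts of `DDS2021_thm_3_2_of_residueChain` then hold with `c₀ = (90·m + 1)·7`. -/

/-- Monotonicity in the program exponent: `S^m ≤ S^m'` for `m ≤ m'` at `S = s^(90·7^(k−1))`,
`s ≥ 2`. (folklore) [cite: DuttaDwivediSaxena2022, §3 "Size blowup" (full version p0036 L952–961)] -/
theorem stagePow_pow_mono {s k m m' : ℕ} (hs : 2 ≤ s) (hmm : m ≤ m') :
    (s ^ (90 * 7 ^ (k - 1))) ^ m ≤ (s ^ (90 * 7 ^ (k - 1))) ^ m' :=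
  Nat.pow_le_pow_right (Nat.one_le_pow _ _ (by omega)) hmm

/-- Powers of the one parameter are again one parameters: everything `≤ S` is `≤ S^m` (`1 ≤ m`).
(folklore) [cite: DuttaDwivediSaxena2022, §3 "Size blowup" (full version p0036 L952–961)] -/
theorem le_stagePow_pow {s k x m : ℕ} (hs : 2 ≤ s) (hm : 1 ≤ m) (hx : x ≤ s ^ (90 * 7 ^ (k - 1))) :
    x ≤ (s ^ (90 * 7 ^ (k - 1))) ^ m :=
  hx.trans (by
    calc s ^ (90 * 7 ^ (k - 1)) = (s ^ (90 * 7 ^ (k - 1))) ^ 1 := (pow_one _).symm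
      _ ≤ (s ^ (90 * 7 ^ (k - 1))) ^ m := Nat.pow_le_pow_right (Nat.one_le_pow _ _ (by omega)) hm)

/-- ★ **The budget conjuncts at `σ := S^m`** (`1 ≤ m`; `c₀ = (90m + 1)·7`): `(σ+1)^7 ≤ s^(c₀·7^(k−1))`,
`2 ≤ σ`, `deg f♯ + k ≤ σ` (`deg f♯ ≤ d`, `d, k ≤ s`, `2 ≤ s`).
[cite: DuttaDwivediSaxena2022, Thm. 3.2 "size `s^{O(k·7^k)}`" (full version p0026 L713–715); §3 "Size blowup" (p0036 L952–961)] -/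
theorem residueChainBudget_pow {d k s δ : ℕ} (hks : k ≤ s) (hds : d ≤ s) (hs : 2 ≤ s) (hδ : δ ≤ d)
    {m : ℕ} (hm : 1 ≤ m) :
    ((s ^ (90 * 7 ^ (k - 1))) ^ m + 1) ^ 7 ≤ s ^ ((90 * m + 1) * 7 * 7 ^ (k - 1)) ∧
      2 ≤ (s ^ (90 * 7 ^ (k - 1))) ^ m ∧ δ + k ≤ (s ^ (90 * 7 ^ (k - 1))) ^ m := by
  have hs1 : 1 ≤ s := by omega
  have h7 : 1 ≤ 7 ^ (k - 1) := Nat.one_le_pow _ _ (by norm_num)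
  have hσ : (s ^ (90 * 7 ^ (k - 1))) ^ m ≤ s ^ (90 * m * 7 ^ (k - 1)) := pow_le_stagePow (le_refl _) m
  have h := succ_pow_le_stagePow (C := 90 * m) (k := k) hs hσ 7
  have hS2 : s ^ 2 ≤ s ^ (90 * 7 ^ (k - 1)) := Nat.pow_le_pow_right hs1 (by omega)
  have hsq : δ + k ≤ s ^ 2 := by nlinarith
  have h2s : 2 ≤ s ^ 2 := by nlinarith
  refine ⟨h.trans (Nat.pow_le_pow_right hs1 (le_of_eq (by ring))),
    le_stagePow_pow hs hm (h2s.trans hS2), le_stagePow_pow hs hm (hsq.trans hS2)⟩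

end DDS2021

end Literature.Computability.AlgebraicComplexity
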